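import Summits.RiemannHypothesis.RiemannHypothesis.Theorems.HandoffUpperClauses
import Summits.RiemannHypothesis.RiemannHypothesis.Theorems.SemilocalNegCertThirteen
import Summits.RiemannHypothesis.RiemannHypothesis.Theorems.SemilocalNegCertSeventeen
import Summits.RiemannHypothesis.RiemannHypothesis.Theorems.SemilocalNegCertNineteen
import Summits.RiemannHypothesis.RiemannHypothesis.Theorems.SemilocalNegCertTwentyThreeLight
import Summits.RiemannHypothesis.RiemannHypothesis.Theorems.SemilocalNegCertTwentyNineLight
import Summits.RiemannHypothesis.RiemannHypothesis.Theorems.SemilocalNegCertUptoThirtyOne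
import Summits.RiemannHypothesis.RiemannHypothesis.Theorems.SemilocalNegCertUptoThirtySeven
import HarnessLib

/-!
# HANDOFF — the RH-free UPPER clauses `a*(S_q) < (log q⁺)/2` as THEOREMS for the primes `17 ≤ q ≤ 41` (cell rh-explicit; A4 Lean lane cc-s2-4 gen9 for TRACK «HANDOFF»)

HONEST FRAMING. Nothing here bears on the truth of RH. `HandoffUpperClauses.lean` (theory-2) made the per-prime UPPER clause of the handoff card —
«the OLD form `{p < q}` IS negative somewhere on the window of `q`», `a*(S_q) < (log q⁺)/2`, equivalently `0 < r(q)`, `0 < D_q((log q⁺)/2)` — a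
TREE THEOREM for `q ≤ 13` from the cc-s2-4 kernel wall certificates. This file does the same bookkeeping for `q = 17, 19, 23, 29, 31, 37, 41`,
from the wall instances of the LIGHT layout (`SemilocalGridMoments.lean`: increment proved once, grid pieces from the moment tables
`SemilocalGridMomentsData*`): `a*(S_17) ≤ 143/100`, `a*(S_19) ≤ 95/64`, `a*(S_23) ≤ 203/128`, `a*(S_29) ≤ 435/256`, `a*(S_31) ≤ 443/256`, `a*(S_37) ≤ 233/128`, `a*(S_41) ≤ 15/8` (each `< (log q⁺)/2`).

* §1 `primesBelow` / `nextPrime` arithmetic; §2 **`a*(S_q) < (log q⁺)/2`** (`weilSemilocalThreshold_primesBelow_*_lt`);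
* §3 `0 < r(q)` (`handoffLoad_*_pos`), `0 < D_q((log q⁺)/2)`, non-vacuity `¬ WeilSemilocalPositivityOn S_q ((log q⁺)/2)`, and the one-sided wall
  offsets `δ*(q) ≤ b_q − (log q)/2` (the T2 / UC column) — with `HandoffUpperClauses`  the upper clause is a THEOREM for
  every prime `q ≤ 41`.

References: H. Yoshida, Adv. Stud. Pure Math. 21 (1992) Prop. 6 (p. 320) (`Yoshida1992HermitianForms`); A. Connes, C. Consani, *Spectral triples and
ζ-cycles*, Enseign. Math. 69 (2023) 93–148 = arXiv:2106.01715, §2 (`ConnesConsani2023`); the certificates are the tree's (cc-s2-4, `SemilocalNegCert*`).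
-/

set_option linter.dupNamespace false  -- the mandated namespace repeats `RiemannHypothesis`

noncomputable section

open Set Literature.NumberTheory.LFunctions
open Summit.RiemannHypothesis.RiemannHypothesis.Theorems
open Summit.RiemannHypothesis.RiemannHypothesis.Theorems.Handoff (ConsecutivePrimes)
open Summit.RiemannHypothesis.RiemannHypothesis.Theorems.HandoffDecomposition
open Summit.RiemannHypothesis.RiemannHypothesis.Theorems.HandoffSemilocalEnergy
open Summit.RiemannHypothesis.RiemannHypothesis.Theorems.HandoffLoadCeiling
open Summit.RiemannHypothesis.RiemannHypothesis.Theorems.HandoffMarginLaw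
open Summit.RiemannHypothesis.RiemannHypothesis.Theorems.MotivicDoor.SemilocalThreshold
open Summit.RiemannHypothesis.RiemannHypothesis.Theorems.SemilocalPolyWitness

namespace Summit.RiemannHypothesis.RiemannHypothesis.Theorems.HandoffUpperClauses

/-! ## §1  Arithmetic of the windows `17 ≤ q ≤ 41` -/

/-- `nextPrime 17 = 19`. [folklore] -/
theorem nextPrime_seventeen : nextPrime 17 = 19 :=
  nextPrime_eq (by norm_num) (by norm_num) (fun m h1 h2 ↦ by interval_cases m; decide)

/-- `(17, 19)` is a consecutive-prime pair. [folklore] -/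
theorem consecutivePrimes_seventeen_nineteen : ConsecutivePrimes 17 19 := by
  have h := consecutivePrimes_nextPrime (show Nat.Prime 17 by norm_num)
  rwa [nextPrime_seventeen] at h

/-- `{p < 17}` as a literal finset. [folklore] -/
theorem primesBelow_seventeen : Nat.primesBelow 17 = {2, 3, 5, 7, 11, 13} := by decide

/-- `nextPrime 19 = 23`. [folklore] -/
theorem nextPrime_nineteen : nextPrime 19 = 23 :=
  nextPrime_eq (by norm_num) (by norm_num) (fun m h1 h2 ↦ by interval_cases m <;> decide)

/-- `(19, 23)` is a consecutive-prime pair. [folklore] -/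
theorem consecutivePrimes_nineteen_twentythree : ConsecutivePrimes 19 23 := by
  have h := consecutivePrimes_nextPrime (show Nat.Prime 19 by norm_num)
  rwa [nextPrime_nineteen] at h

/-- `{p < 19}` as a literal finset. [folklore] -/
theorem primesBelow_nineteen : Nat.primesBelow 19 = {2, 3, 5, 7, 11, 13, 17} := by decide

/-- `nextPrime 23 = 29`. [folklore] -/
theorem nextPrime_twentythree : nextPrime 23 = 29 :=
  nextPrime_eq (by norm_num) (by norm_num) (fun m h1 h2 ↦ by interval_cases m <;> decide)

/-- `(23, 29)` is a consecutive-prime pair. [folklore] -/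
theorem consecutivePrimes_twentythree_twentynine : ConsecutivePrimes 23 29 := by
  have h := consecutivePrimes_nextPrime (show Nat.Prime 23 by norm_num)
  rwa [nextPrime_twentythree] at h

/-- `{p < 23}` as a literal finset. [folklore] -/
theorem primesBelow_twentythree : Nat.primesBelow 23 = {2, 3, 5, 7, 11, 13, 17, 19} := by decide

/-- `nextPrime 29 = 31`. [folklore] -/
theorem nextPrime_twentynine : nextPrime 29 = 31 :=
  nextPrime_eq (by norm_num) (by norm_num) (fun m h1 h2 ↦ by interval_cases m; decide)

/-- `(29, 31)` is a consecutive-prime pair. [folklore] -/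
theorem consecutivePrimes_twentynine_thirtyone : ConsecutivePrimes 29 31 := by
  have h := consecutivePrimes_nextPrime (show Nat.Prime 29 by norm_num)
  rwa [nextPrime_twentynine] at h

/-- `{p < 29}` as a literal finset. [folklore] -/
theorem primesBelow_twentynine : Nat.primesBelow 29 = {2, 3, 5, 7, 11, 13, 17, 19, 23} := by decide

/-- `nextPrime 31 = 37`. [folklore] -/
theorem nextPrime_thirtyone : nextPrime 31 = 37 :=
  nextPrime_eq (by norm_num) (by norm_num) (fun m h1 h2 ↦ by interval_cases m <;> decide)

/-- `(31, 37)` is a consecutive-prime pair. [folklore] -/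
theorem consecutivePrimes_thirtyone_thirtyseven : ConsecutivePrimes 31 37 := by
  have h := consecutivePrimes_nextPrime (show Nat.Prime 31 by norm_num)
  rwa [nextPrime_thirtyone] at h

/-- `{p < 31}` as a literal finset. [folklore] -/
theorem primesBelow_thirtyone : Nat.primesBelow 31 = {2, 3, 5, 7, 11, 13, 17, 19, 23, 29} := by decide

/-- `nextPrime 37 = 41`. [folklore] -/
theorem nextPrime_thirtyseven : nextPrime 37 = 41 :=
  nextPrime_eq (by norm_num) (by norm_num) (fun m h1 h2 ↦ by interval_cases m <;> decide)

/-- `(37, 41)` is a consecutive-prime pair. [folklore] -/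
theorem consecutivePrimes_thirtyseven_fortyone : ConsecutivePrimes 37 41 := by
  have h := consecutivePrimes_nextPrime (show Nat.Prime 37 by norm_num)
  rwa [nextPrime_thirtyseven] at h

/-- `{p < 37}` as a literal finset. [folklore] -/
theorem primesBelow_thirtyseven : Nat.primesBelow 37 = {2, 3, 5, 7, 11, 13, 17, 19, 23, 29, 31} := by decide

/-- `nextPrime 41 = 43`. [folklore] -/
theorem nextPrime_fortyone : nextPrime 41 = 43 :=
  nextPrime_eq (by norm_num) (by norm_num) (fun m h1 h2 ↦ by interval_cases m; decide)

/-- `(41, 43)` is a consecutive-prime pair. [folklore] -/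
theorem consecutivePrimes_fortyone_fortythree : ConsecutivePrimes 41 43 := by
  have h := consecutivePrimes_nextPrime (show Nat.Prime 41 by norm_num)
  rwa [nextPrime_fortyone] at h

/-- `{p < 41}` as a literal finset. [folklore] -/
theorem primesBelow_fortyone : Nat.primesBelow 41 = {2, 3, 5, 7, 11, 13, 17, 19, 23, 29, 31, 37} := by decide

/-! ## §2  The upper clauses `a*(S_q) < (log q⁺)/2`, `17 ≤ q ≤ 41` -/

/-- **q = 17**: `a*(S_17) < (log 19)/2` (tree `a*(S_17) ≤ 143/100` < (log 18)/2). [cite: Yoshida1992HermitianForms, Prop. 6 (p. 320); tree certificate `SemilocalNegCertThirteen`] -/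
theorem weilSemilocalThreshold_primesBelow_seventeen_lt : weilSemilocalThreshold (Nat.primesBelow 17) < Real.log 19 / 2 := by
  rw [primesBelow_seventeen]
  have h := weilSemilocalThreshold_uptoThirteen_lt_log_eighteen_half
  have h2 : Real.log 18 ≤ Real.log 19 := Real.log_le_log (by norm_num) (by norm_num)
  linarith

/-- **q = 19**: `a*(S_19) < (log 23)/2` (tree `a*(S_19) ≤ 95/64` < (log 20)/2). [cite: Yoshida1992HermitianForms, Prop. 6 (p. 320); tree certificate `SemilocalNegCertSeventeen`] -/
theorem weilSemilocalThreshold_primesBelow_nineteen_lt : weilSemilocalThreshold (Nat.primesBelow 19) < Real.log 23 / 2 := by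
  rw [primesBelow_nineteen]
  have h := weilSemilocalThreshold_uptoSeventeen_lt_log_twenty_half
  have h2 : Real.log 20 ≤ Real.log 23 := Real.log_le_log (by norm_num) (by norm_num)
  linarith

/-- **q = 23**: `a*(S_23) < (log 29)/2` (tree `a*(S_23) ≤ 203/128` < (log 24)/2). [cite: Yoshida1992HermitianForms, Prop. 6 (p. 320); tree certificate `SemilocalNegCertNineteen`] -/
theorem weilSemilocalThreshold_primesBelow_twentythree_lt : weilSemilocalThreshold (Nat.primesBelow 23) < Real.log 29 / 2 := by
  rw [primesBelow_twentythree]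
  have h := weilSemilocalThreshold_uptoNineteen_lt_log_twentyfour_half
  have h2 : Real.log 24 ≤ Real.log 29 := Real.log_le_log (by norm_num) (by norm_num)
  linarith

/-- **q = 29**: `a*(S_29) < (log 31)/2` (tree `a*(S_29) ≤ 435/256` < (log 30)/2). [cite: Yoshida1992HermitianForms, Prop. 6 (p. 320); tree certificate `SemilocalNegCertTwentyThree`] -/
theorem weilSemilocalThreshold_primesBelow_twentynine_lt : weilSemilocalThreshold (Nat.primesBelow 29) < Real.log 31 / 2 := by
  rw [primesBelow_twentynine]
  have h := weilSemilocalThreshold_uptoTwentyThree_lt_log_thirty_half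
  have h2 : Real.log 30 ≤ Real.log 31 := Real.log_le_log (by norm_num) (by norm_num)
  linarith

/-- **q = 31**: `a*(S_31) < (log 37)/2` (tree `a*(S_31) ≤ 443/256` < (log 32)/2). [cite: Yoshida1992HermitianForms, Prop. 6 (p. 320); tree certificate `SemilocalNegCertTwentyNine`] -/
theorem weilSemilocalThreshold_primesBelow_thirtyone_lt : weilSemilocalThreshold (Nat.primesBelow 31) < Real.log 37 / 2 := by
  rw [primesBelow_thirtyone]
  have h := weilSemilocalThreshold_uptoTwentyNine_lt_log_thirtytwo_half
  have h2 : Real.log 32 ≤ Real.log 37 := Real.log_le_log (by norm_num) (by norm_num)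
  linarith

/-- **q = 37**: `a*(S_37) < (log 41)/2` (tree `a*(S_37) ≤ 233/128` < (log 40)/2). [cite: Yoshida1992HermitianForms, Prop. 6 (p. 320); tree certificate `SemilocalNegCertUptoThirtyOne`] -/
theorem weilSemilocalThreshold_primesBelow_thirtyseven_lt : weilSemilocalThreshold (Nat.primesBelow 37) < Real.log 41 / 2 := by
  rw [primesBelow_thirtyseven]
  have h := weilSemilocalThreshold_uptoThirtyOne_lt_log_forty_half
  have h2 : Real.log 40 ≤ Real.log 41 := Real.log_le_log (by norm_num) (by norm_num)
  linarith

/-- **q = 41**: `a*(S_41) < (log 43)/2` (tree `a*(S_41) ≤ 15/8` < (log 43)/2). [cite: Yoshida1992HermitianForms, Prop. 6 (p. 320); tree certificate `SemilocalNegCertUptoThirtySeven`] -/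
theorem weilSemilocalThreshold_primesBelow_fortyone_lt : weilSemilocalThreshold (Nat.primesBelow 41) < Real.log 43 / 2 := by
  rw [primesBelow_fortyone]
  exact weilSemilocalThreshold_uptoThirtySeven_lt_log_fortythree_half

/-! ## §3  Consequences: positive loads, aggregate deficits, non-vacuity, one-sided wall offsets -/

/-- **`0 < r(17)`** (RH-free). [this track] -/
theorem handoffLoad_seventeen_nineteen_pos : 0 < handoffLoad 17 19 :=
  (handoffLoad_pos_iff consecutivePrimes_seventeen_nineteen).2 weilSemilocalThreshold_primesBelow_seventeen_lt

/-- **`0 < r(19)`** (RH-free). [this track] -/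
theorem handoffLoad_nineteen_twentythree_pos : 0 < handoffLoad 19 23 :=
  (handoffLoad_pos_iff consecutivePrimes_nineteen_twentythree).2 weilSemilocalThreshold_primesBelow_nineteen_lt

/-- **`0 < r(23)`** (RH-free). [this track] -/
theorem handoffLoad_twentythree_twentynine_pos : 0 < handoffLoad 23 29 :=
  (handoffLoad_pos_iff consecutivePrimes_twentythree_twentynine).2 weilSemilocalThreshold_primesBelow_twentythree_lt

/-- **`0 < r(29)`** (RH-free). [this track] -/
theorem handoffLoad_twentynine_thirtyone_pos : 0 < handoffLoad 29 31 :=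
  (handoffLoad_pos_iff consecutivePrimes_twentynine_thirtyone).2 weilSemilocalThreshold_primesBelow_twentynine_lt

/-- **`0 < r(31)`** (RH-free). [this track] -/
theorem handoffLoad_thirtyone_thirtyseven_pos : 0 < handoffLoad 31 37 :=
  (handoffLoad_pos_iff consecutivePrimes_thirtyone_thirtyseven).2 weilSemilocalThreshold_primesBelow_thirtyone_lt

/-- **`0 < r(37)`** (RH-free). [this track] -/
theorem handoffLoad_thirtyseven_fortyone_pos : 0 < handoffLoad 37 41 :=
  (handoffLoad_pos_iff consecutivePrimes_thirtyseven_fortyone).2 weilSemilocalThreshold_primesBelow_thirtyseven_lt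

/-- **`0 < r(41)`** (RH-free). [this track] -/
theorem handoffLoad_fortyone_fortythree_pos : 0 < handoffLoad 41 43 :=
  (handoffLoad_pos_iff consecutivePrimes_fortyone_fortythree).2 weilSemilocalThreshold_primesBelow_fortyone_lt

/-- The aggregate deficits at the window ends are STRICTLY positive: `0 < D_q((log q⁺)/2)`, `17 ≤ q ≤ 41`. [this track] -/
theorem aggregateDeficit_pos_seventeen_to_fortyone :
    0 < aggregateDeficit 17 (Real.log 19 / 2) ∧
      0 < aggregateDeficit 19 (Real.log 23 / 2) ∧
      0 < aggregateDeficit 23 (Real.log 29 / 2) ∧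
      0 < aggregateDeficit 29 (Real.log 31 / 2) ∧
      0 < aggregateDeficit 31 (Real.log 37 / 2) ∧
      0 < aggregateDeficit 37 (Real.log 41 / 2) ∧
      0 < aggregateDeficit 41 (Real.log 43 / 2) :=
  ⟨aggregateDeficit_pos_iff.2 weilSemilocalThreshold_primesBelow_seventeen_lt,
    aggregateDeficit_pos_iff.2 weilSemilocalThreshold_primesBelow_nineteen_lt,
    aggregateDeficit_pos_iff.2 weilSemilocalThreshold_primesBelow_twentythree_lt,
    aggregateDeficit_pos_iff.2 weilSemilocalThreshold_primesBelow_twentynine_lt,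
    aggregateDeficit_pos_iff.2 weilSemilocalThreshold_primesBelow_thirtyone_lt,
    aggregateDeficit_pos_iff.2 weilSemilocalThreshold_primesBelow_thirtyseven_lt,
    aggregateDeficit_pos_iff.2 weilSemilocalThreshold_primesBelow_fortyone_lt⟩

/-- **Non-vacuity of the handoff, `17 ≤ q ≤ 41`**: the OLD form `{p < q}` is NOT non-negative on the window end of `q`. [cite: ConnesConsani2023, §2.2–2.4; this track] -/
theorem not_weilSemilocalPositivityOn_window_end_seventeen_to_fortyone :
    ¬ WeilSemilocalPositivityOn (Nat.primesBelow 17) (Real.log 19 / 2) ∧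
      ¬ WeilSemilocalPositivityOn (Nat.primesBelow 19) (Real.log 23 / 2) ∧
      ¬ WeilSemilocalPositivityOn (Nat.primesBelow 23) (Real.log 29 / 2) ∧
      ¬ WeilSemilocalPositivityOn (Nat.primesBelow 29) (Real.log 31 / 2) ∧
      ¬ WeilSemilocalPositivityOn (Nat.primesBelow 31) (Real.log 37 / 2) ∧
      ¬ WeilSemilocalPositivityOn (Nat.primesBelow 37) (Real.log 41 / 2) ∧
      ¬ WeilSemilocalPositivityOn (Nat.primesBelow 41) (Real.log 43 / 2) := by
  simp only [not_weilSemilocalPositivityOn_iff_weilSemilocalThreshold_lt]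
  exact ⟨weilSemilocalThreshold_primesBelow_seventeen_lt,
    weilSemilocalThreshold_primesBelow_nineteen_lt,
    weilSemilocalThreshold_primesBelow_twentythree_lt,
    weilSemilocalThreshold_primesBelow_twentynine_lt,
    weilSemilocalThreshold_primesBelow_thirtyone_lt,
    weilSemilocalThreshold_primesBelow_thirtyseven_lt,
    weilSemilocalThreshold_primesBelow_fortyone_lt⟩

/-- `δ*(17) ≤ 143/100 − (log 17)/2` (one-sided, RH-free; the T2/UC column). [this track; tree certificate `SemilocalNegCertThirteen`] -/
theorem wallOffset_seventeen_le : wallOffset 17 ≤ 143 / 100 - Real.log 17 / 2 := by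
  have h := weilSemilocalThreshold_uptoThirteen_le_143
  push_cast at h
  rw [wallOffset, primesBelow_seventeen]
  push_cast
  linarith

/-- `δ*(19) ≤ 95/64 − (log 19)/2` (one-sided, RH-free; the T2/UC column). [this track; tree certificate `SemilocalNegCertSeventeen`] -/
theorem wallOffset_nineteen_le : wallOffset 19 ≤ 95 / 64 - Real.log 19 / 2 := by
  have h := weilSemilocalThreshold_uptoSeventeen_le
  push_cast at h
  rw [wallOffset, primesBelow_nineteen]
  push_cast
  linarith

/-- `δ*(23) ≤ 203/128 − (log 23)/2` (one-sided, RH-free; the T2/UC column). [this track; tree certificate `SemilocalNegCertNineteen`] -/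
theorem wallOffset_twentythree_le : wallOffset 23 ≤ 203 / 128 - Real.log 23 / 2 := by
  have h := weilSemilocalThreshold_uptoNineteen_le
  push_cast at h
  rw [wallOffset, primesBelow_twentythree]
  push_cast
  linarith

/-- `δ*(29) ≤ 435/256 − (log 29)/2` (one-sided, RH-free; the T2/UC column). [this track; tree certificate `SemilocalNegCertTwentyThree`] -/
theorem wallOffset_twentynine_le : wallOffset 29 ≤ 435 / 256 - Real.log 29 / 2 := by
  have h := weilSemilocalThreshold_uptoTwentyThree_le
  push_cast at h
  rw [wallOffset, primesBelow_twentynine]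
  push_cast
  linarith

/-- `δ*(31) ≤ 443/256 − (log 31)/2` (one-sided, RH-free; the T2/UC column). [this track; tree certificate `SemilocalNegCertTwentyNine`] -/
theorem wallOffset_thirtyone_le : wallOffset 31 ≤ 443 / 256 - Real.log 31 / 2 := by
  have h := weilSemilocalThreshold_uptoTwentyNine_le
  push_cast at h
  rw [wallOffset, primesBelow_thirtyone]
  push_cast
  linarith

/-- `δ*(37) ≤ 233/128 − (log 37)/2` (one-sided, RH-free; the T2/UC column). [this track; tree certificate `SemilocalNegCertUptoThirtyOne`] -/
theorem wallOffset_thirtyseven_le : wallOffset 37 ≤ 233 / 128 - Real.log 37 / 2 := by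
  have h := weilSemilocalThreshold_uptoThirtyOne_le
  push_cast at h
  rw [wallOffset, primesBelow_thirtyseven]
  push_cast
  linarith

/-- `δ*(41) ≤ 15/8 − (log 41)/2` (one-sided, RH-free; the T2/UC column). [this track; tree certificate `SemilocalNegCertUptoThirtySeven`] -/
theorem wallOffset_fortyone_le : wallOffset 41 ≤ 15 / 8 - Real.log 41 / 2 := by
  have h := weilSemilocalThreshold_uptoThirtySeven_le
  push_cast at h
  rw [wallOffset, primesBelow_fortyone]
  push_cast
  linarith

end Summit.RiemannHypothesis.RiemannHypothesis.Theorems.HandoffUpperClauses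

end
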